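import Mathlib
import Literature.Analysis.FluidPDE.Tao2016AveragedNS.ShiftSetCascadeFlows
import Literature.Analysis.FluidPDE.Tao2016AveragedNS.RestartedCascadeFlows
import Summits.NavierStokesRegularity.NavierStokesRegularity.Theorems.TaoLadderRungTwoFlatCertificateGluePiecewiseGaussianOn
import HarnessLib

/-!
# Certificate glue on a shift set `𝕊`, VIII: DISCHARGING THE `∀`-STATICS of the glue theorems for the standard
  envelope families — geometric wake envelope, two-level quiet-tail profile, piecewise-Gaussian weight — from
  finitely many SCALAR checks (helper for item stmt-NavierStokesRegularity-22987 `FlatGapCertificatesV2`, crux K_A♭ of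
  route TaoLadderRungTwoFlat; cell harvest/h2-tao-ladder, p1 g13)

The glue theorems (`gapData₂On_of_windowCertificate`, `stub_rung_quarter_of_windowCertificate`, …) carry families of
scalar inequalities indexed by ALL wake shells `j < -Kb` and ALL quiet shells `K ≥ Ka+1`. For the natural shapes a
certificate uses they are MONOTONE in the shell index, so each family follows from its first one or two members:

* WAKE (`j < -Kb`, depth `|j|`): reference envelope `Zb j = Cb (1+ε₀)^{-γ j}` (`Cb > 0`, `0 ≤ γ ≤ 1`), flow envelope
  `Zf j = 2 (Zb j + r/Cw)`. Then `Ẑf_j = Zf(j-1)`; the frozen-wake CLOSING holds for all `j ≤ -Kb-1` as soon as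
  `32 c Cα (1+ε₀)^{2γ} · f(-Kb-1) ≤ 1`, `f(j) = (1+ε₀)^{5j/2}(Zb j + r/Cw)` (`wake_closing`); the drift is bounded by
  `Dmax = 32 c Cα (1+ε₀)^{2γ} (1+ε₀)^{-5(Kb+1)/2}(Zb(-Kb-1) + r/Cw)²` (`wake_drift`); the WAKE-SHIFT inequality holds for all
  `j ≤ -Kb-1` as soon as it holds with the majorised drift at `j = -Kb-1` (`wake_shift`); tameness `Zb j ≤ Cb (1+ε₀)^{-j}`
  (`wake_tame`); and the sign/domination clauses (`wake_signs`).
* QUIET TAIL (`K ≥ Ka+1`): two-level profile `ν Ka = ν₀`, `ν K = ν₁` (`K ≥ Ka+1`) and the piecewise-Gaussian weight: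
  THIN for all `K ≥ Ka+1` from the single check at `K = Ka+1` when `Ka ≥ 4` (`quiet_thin`); SLOWNESS from the checks at
  `K = Ka+1, Ka+2` when `Ka ≥ 2` (`quiet_slow`); CLOSING from the checks at `K = Ka+1, Ka+2` (`quiet_closing`);
  QUIET-SHIFT from `ν₁ (1+ε₀)^{θ₀} ≤ ρ` (`quiet_shift`); signs/max (`quiet_signs`).

HONEST FRAMING: elementary real inequalities (completed squares, geometric monotonicity); nothing is asserted about any
table or flow and nothing here is a statement about the Navier–Stokes equations.
-/

noncomputable section

-- the sub-problem namespace repeats the summit name by design (D-0017)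
set_option linter.dupNamespace false

namespace Summit.NavierStokesRegularity.NavierStokesRegularity.Theorems

open Set Literature.Analysis.FluidPDE Literature.Analysis.FluidPDE.TaoCascade

namespace CertificateGlueOn

/-! ### Wake envelopes -/

section Wake

variable {ε₀ Cb γ r Cw c Cα θ₀ : ℝ} {Kb : ℤ} {Zb Zf w : ℤ → ℝ}

/-- The geometric wake envelope is positive. [folklore] -/
theorem wake_pos (hε : 0 < ε₀) (hCb : 0 < Cb) (hZb : ∀ j : ℤ, Zb j = Cb * (1 + ε₀) ^ (-(γ * j))) (j : ℤ) :
    0 < Zb j := by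
  rw [hZb]; exact mul_pos hCb (Real.rpow_pos_of_pos (by linarith) _)

/-- The geometric wake envelope grows with depth: `Zb j ≤ Zb j'` for `j' ≤ j` (`γ ≥ 0`). [folklore] -/
theorem wake_mono (hε : 0 < ε₀) (hCb : 0 < Cb) (hγ : 0 ≤ γ)
    (hZb : ∀ j : ℤ, Zb j = Cb * (1 + ε₀) ^ (-(γ * j))) {j j' : ℤ} (hjj : j' ≤ j) : Zb j ≤ Zb j' := by
  rw [hZb, hZb]
  refine mul_le_mul_of_nonneg_left (Real.rpow_le_rpow_of_exponent_le (by linarith) ?_) hCb.le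
  have : (j' : ℝ) ≤ j := by exact_mod_cast hjj
  nlinarith

/-- One shell deeper costs a factor `(1+ε₀)^γ`: `Zb (j-1) = (1+ε₀)^γ · Zb j`. [folklore] -/
theorem wake_step (hε : 0 < ε₀) (hZb : ∀ j : ℤ, Zb j = Cb * (1 + ε₀) ^ (-(γ * j))) (j : ℤ) :
    Zb (j - 1) = (1 + ε₀) ^ γ * Zb j := by
  rw [hZb, hZb]
  have hq : 0 < 1 + ε₀ := by linarith
  have : (-(γ * (((j - 1 : ℤ) : ℝ)))) = γ + (-(γ * j)) := by push_cast; ring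
  rw [this, Real.rpow_add hq]
  ring

/-- **Signs and domination of the wake envelopes**: with `Zf j = 2(Zb j + r/Cw)`, for `j ≤ -Kb ≤ 0`: `0 < Zf j`,
`2Cb ≤ Zf j`, `0 ≤ Zb j`, and `Zb j + r/w j ≤ Zf j/2` whenever `w j = Cw` (`j < 0`). [folklore] -/
theorem wake_signs (hε : 0 < ε₀) (hCb : 0 < Cb) (hγ : 0 ≤ γ) (hr : 0 ≤ r) (hCw : 1 ≤ Cw)
    (hZb : ∀ j : ℤ, Zb j = Cb * (1 + ε₀) ^ (-(γ * j))) (hZf : ∀ j : ℤ, Zf j = 2 * (Zb j + r / Cw))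
    (hwn : ∀ k : ℤ, k < 0 → w k = Cw) (hKb : 0 ≤ Kb) :
    (∀ j, j ≤ -Kb → 0 < Zf j) ∧ (∀ j, j < -Kb → 2 * Cb ≤ Zf j) ∧ (∀ j, j < -Kb → 0 ≤ Zb j) ∧
      (∀ j, j < -Kb → Zb j + r / w j ≤ Zf j / 2) := by
  have hρ₀ : 0 ≤ r / Cw := div_nonneg hr (by linarith)
  have hZb1 : ∀ j, j ≤ 0 → Cb ≤ Zb j := by
    intro j hj
    rw [hZb]
    have h1 : (1 : ℝ) ≤ (1 + ε₀) ^ (-(γ * j)) :=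
      Real.one_le_rpow (by linarith) (by have : (j : ℝ) ≤ 0 := (by exact_mod_cast hj); nlinarith)
    nlinarith
  refine ⟨fun j hj => ?_, fun j hj => ?_, fun j _ => (wake_pos hε hCb hZb j).le, fun j hj => ?_⟩
  · rw [hZf]; have := wake_pos hε hCb hZb j; positivity
  · rw [hZf]; have := hZb1 j (by omega); linarith
  · rw [hZf, hwn j (by omega)]; linarith

/-- **Tameness of the geometric wake envelope**: `Zb j ≤ Cb (1+ε₀)^{-j}` for `j ≤ 0` (`0 ≤ γ ≤ 1`). [folklore] -/
theorem wake_tame (hε : 0 < ε₀) (hCb : 0 < Cb) (hγ1 : γ ≤ 1)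
    (hZb : ∀ j : ℤ, Zb j = Cb * (1 + ε₀) ^ (-(γ * j))) (j : ℤ) (hj : j ≤ 0) :
    Zb j ≤ Cb * (1 + ε₀) ^ (-(j : ℝ)) := by
  rw [hZb]
  refine mul_le_mul_of_nonneg_left (Real.rpow_le_rpow_of_exponent_le (by linarith) ?_) hCb.le
  have : (j : ℝ) ≤ 0 := by exact_mod_cast hj
  nlinarith

/-- The three-shell maximum of the flow envelope is its deepest member: `Ẑf_j = Zf(j-1)`. [folklore] -/
theorem wake_max3 (hε : 0 < ε₀) (hCb : 0 < Cb) (hγ : 0 ≤ γ)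
    (hZb : ∀ j : ℤ, Zb j = Cb * (1 + ε₀) ^ (-(γ * j))) (hZf : ∀ j : ℤ, Zf j = 2 * (Zb j + r / Cw)) (j : ℤ) :
    max (Zf (j - 1)) (max (Zf j) (Zf (j + 1))) = Zf (j - 1) := by
  have hmono : ∀ a b : ℤ, a ≤ b → Zf b ≤ Zf a := fun a b hab => by
    rw [hZf, hZf]; have := wake_mono hε hCb hγ hZb hab; linarith
  refine max_eq_left (max_le (hmono _ _ (by omega)) (hmono _ _ (by omega)))

/-- The frozen-wake drift majorant: `c·8Cα(1+ε₀)^{5j/2}Ẑf_j² ≤ 32 c Cα (1+ε₀)^{2γ} · (1+ε₀)^{5j/2} (Zb j + r/Cw)²`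
(`Ẑf_j = Zf(j-1) = 2(Zb(j-1) + r/Cw) ≤ 2(1+ε₀)^γ (Zb j + r/Cw)`). [folklore] -/
theorem wake_drift_le (hε : 0 < ε₀) (hCb : 0 < Cb) (hγ : 0 ≤ γ) (hr : 0 ≤ r) (hCw : 1 ≤ Cw) (hc : 0 ≤ c)
    (hCα : 0 ≤ Cα) (hZb : ∀ j : ℤ, Zb j = Cb * (1 + ε₀) ^ (-(γ * j)))
    (hZf : ∀ j : ℤ, Zf j = 2 * (Zb j + r / Cw)) (j : ℤ) :
    c * (8 * Cα * (1 + ε₀) ^ ((5 : ℝ) * j / 2) *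
        max (Zf (j - 1)) (max (Zf j) (Zf (j + 1))) * max (Zf (j - 1)) (max (Zf j) (Zf (j + 1)))) ≤
      32 * c * Cα * (1 + ε₀) ^ (2 * γ) * ((1 + ε₀) ^ ((5 : ℝ) * j / 2) * (Zb j + r / Cw) ^ 2) := by
  have hq : 0 < 1 + ε₀ := by linarith
  have hρ₀ : 0 ≤ r / Cw := div_nonneg hr (by linarith)
  rw [wake_max3 hε hCb hγ hZb hZf j, hZf, wake_step hε hZb j]
  have hqγ : 1 ≤ (1 + ε₀) ^ γ := Real.one_le_rpow (by linarith) hγ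
  have hZbj := (wake_pos hε hCb hZb j).le
  -- Zb(j-1) + ρ₀ ≤ (1+ε₀)^γ (Zb j + ρ₀)
  have h1 : (1 + ε₀) ^ γ * Zb j + r / Cw ≤ (1 + ε₀) ^ γ * (Zb j + r / Cw) := by nlinarith
  have h1' : 0 ≤ (1 + ε₀) ^ γ * Zb j + r / Cw := by positivity
  have h2 : (2 * ((1 + ε₀) ^ γ * Zb j + r / Cw)) * (2 * ((1 + ε₀) ^ γ * Zb j + r / Cw)) ≤
      4 * ((1 + ε₀) ^ γ) ^ 2 * (Zb j + r / Cw) ^ 2 := by nlinarith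
  have hsq : ((1 + ε₀) ^ γ) ^ 2 = (1 + ε₀) ^ (2 * γ) := by
    rw [← Real.rpow_natCast, ← Real.rpow_mul hq.le]; norm_num; ring_nf
  have hL : 0 ≤ (1 + ε₀) ^ ((5 : ℝ) * j / 2) := (Real.rpow_pos_of_pos hq _).le
  calc c * (8 * Cα * (1 + ε₀) ^ ((5 : ℝ) * j / 2) * (2 * ((1 + ε₀) ^ γ * Zb j + r / Cw)) *
        (2 * ((1 + ε₀) ^ γ * Zb j + r / Cw)))
      = c * (8 * Cα * (1 + ε₀) ^ ((5 : ℝ) * j / 2)) *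
          ((2 * ((1 + ε₀) ^ γ * Zb j + r / Cw)) * (2 * ((1 + ε₀) ^ γ * Zb j + r / Cw))) := by ring
    _ ≤ c * (8 * Cα * (1 + ε₀) ^ ((5 : ℝ) * j / 2)) * (4 * ((1 + ε₀) ^ γ) ^ 2 * (Zb j + r / Cw) ^ 2) :=
        mul_le_mul_of_nonneg_left h2 (by positivity)
    _ = 32 * c * Cα * (1 + ε₀) ^ (2 * γ) * ((1 + ε₀) ^ ((5 : ℝ) * j / 2) * (Zb j + r / Cw) ^ 2) := by
        rw [hsq]; ring

/-- The closing quantity `f(j) = (1+ε₀)^{5j/2}(Zb j + r/Cw)` increases with `j` (decreases with depth), for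
`γ ≤ 5/2`. [folklore] -/
theorem wake_f_mono (hε : 0 < ε₀) (hCb : 0 < Cb) (hγ : γ ≤ 5 / 2) (hr : 0 ≤ r) (hCw : 1 ≤ Cw)
    (hZb : ∀ j : ℤ, Zb j = Cb * (1 + ε₀) ^ (-(γ * j))) {j j₀ : ℤ} (hj : j ≤ j₀) :
    (1 + ε₀) ^ ((5 : ℝ) * j / 2) * (Zb j + r / Cw) ≤ (1 + ε₀) ^ ((5 : ℝ) * j₀ / 2) * (Zb j₀ + r / Cw) := by
  have hq : 0 < 1 + ε₀ := by linarith
  have hq1 : 1 ≤ 1 + ε₀ := by linarith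
  have hjr : (j : ℝ) ≤ j₀ := by exact_mod_cast hj
  have hρ₀ : 0 ≤ r / Cw := div_nonneg hr (by linarith)
  rw [hZb, hZb, mul_add, mul_add]
  refine add_le_add ?_ ?_
  · -- Cb-term: exponent (5/2 - γ) j
    have e1 : (1 + ε₀) ^ ((5 : ℝ) * j / 2) * (Cb * (1 + ε₀) ^ (-(γ * j))) =
        Cb * (1 + ε₀) ^ ((5 / 2 - γ) * j) := by
      rw [show (5 / 2 - γ) * (j : ℝ) = (5 : ℝ) * j / 2 + -(γ * j) by ring, Real.rpow_add hq]; ring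
    have e2 : (1 + ε₀) ^ ((5 : ℝ) * j₀ / 2) * (Cb * (1 + ε₀) ^ (-(γ * j₀))) =
        Cb * (1 + ε₀) ^ ((5 / 2 - γ) * j₀) := by
      rw [show (5 / 2 - γ) * (j₀ : ℝ) = (5 : ℝ) * j₀ / 2 + -(γ * j₀) by ring, Real.rpow_add hq]; ring
    rw [e1, e2]
    exact mul_le_mul_of_nonneg_left (Real.rpow_le_rpow_of_exponent_le hq1 (by nlinarith)) hCb.le
  · exact mul_le_mul_of_nonneg_right (Real.rpow_le_rpow_of_exponent_le hq1 (by nlinarith)) hρ₀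

/-- **FROZEN-WAKE CLOSING from one scalar check.** If `32 c Cα (1+ε₀)^{2γ} · (1+ε₀)^{-5(Kb+1)/2}(Zb(-Kb-1) + r/Cw) ≤ 1`
then the closing condition `c·(8Cα(1+ε₀)^{5j/2}Ẑf_j² + 0) ≤ Zf_j/2` holds for every `j < -Kb`. [folklore] -/
theorem wake_closing (hε : 0 < ε₀) (hCb : 0 < Cb) (hγ : 0 ≤ γ) (hγ1 : γ ≤ 1) (hr : 0 ≤ r) (hCw : 1 ≤ Cw)
    (hc : 0 ≤ c) (hCα : 0 ≤ Cα) (hZb : ∀ j : ℤ, Zb j = Cb * (1 + ε₀) ^ (-(γ * j)))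
    (hZf : ∀ j : ℤ, Zf j = 2 * (Zb j + r / Cw))
    (hcheck : 32 * c * Cα * (1 + ε₀) ^ (2 * γ) *
      ((1 + ε₀) ^ ((5 : ℝ) * ((-Kb - 1 : ℤ) : ℝ) / 2) * (Zb (-Kb - 1) + r / Cw)) ≤ 1) :
    ∀ j, j < -Kb →
      c * (8 * Cα * (1 + ε₀) ^ ((5 : ℝ) * j / 2) *
        max (Zf (j - 1)) (max (Zf j) (Zf (j + 1))) * max (Zf (j - 1)) (max (Zf j) (Zf (j + 1))) + 0) ≤
        Zf j / 2 := by
  intro j hj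
  have hq : 0 < 1 + ε₀ := by linarith
  have hρ₀ : 0 ≤ r / Cw := div_nonneg hr (by linarith)
  have hX : 0 ≤ Zb j + r / Cw := by have := wake_pos hε hCb hZb j; positivity
  rw [add_zero]
  refine (wake_drift_le hε hCb hγ hr hCw hc hCα hZb hZf j).trans ?_
  have hf := wake_f_mono hε hCb (by linarith) hr hCw hZb (show j ≤ -Kb - 1 by omega)
  have hK : 0 ≤ 32 * c * Cα * (1 + ε₀) ^ (2 * γ) := by
    have := Real.rpow_pos_of_pos hq (2 * γ); positivity
  rw [hZf]
  calc 32 * c * Cα * (1 + ε₀) ^ (2 * γ) * ((1 + ε₀) ^ ((5 : ℝ) * j / 2) * (Zb j + r / Cw) ^ 2)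
      = (32 * c * Cα * (1 + ε₀) ^ (2 * γ) * ((1 + ε₀) ^ ((5 : ℝ) * j / 2) * (Zb j + r / Cw))) *
          (Zb j + r / Cw) := by ring
    _ ≤ 1 * (Zb j + r / Cw) :=
        mul_le_mul_of_nonneg_right ((mul_le_mul_of_nonneg_left hf hK).trans hcheck) hX
    _ = 2 * (Zb j + r / Cw) / 2 := by ring

/-- The squared drift quantity `g(j) = (1+ε₀)^{5j/2}(Zb j + r/Cw)²` increases with `j`, for `γ ≤ 5/4`. [folklore] -/
theorem wake_g_mono (hε : 0 < ε₀) (hCb : 0 < Cb) (hγ1 : γ ≤ 5 / 4) (hr : 0 ≤ r) (hCw : 1 ≤ Cw)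
    (hZb : ∀ j : ℤ, Zb j = Cb * (1 + ε₀) ^ (-(γ * j))) {j j₀ : ℤ} (hj : j ≤ j₀) :
    (1 + ε₀) ^ ((5 : ℝ) * j / 2) * (Zb j + r / Cw) ^ 2 ≤ (1 + ε₀) ^ ((5 : ℝ) * j₀ / 2) * (Zb j₀ + r / Cw) ^ 2 := by
  have hq : 0 < 1 + ε₀ := by linarith
  have hq1 : 1 ≤ 1 + ε₀ := by linarith
  have hjr : (j : ℝ) ≤ j₀ := by exact_mod_cast hj
  have hρ₀ : 0 ≤ r / Cw := div_nonneg hr (by linarith)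
  -- write as a square of h(j) := (1+ε₀)^{5j/4}(Zb j + ρ₀), which is increasing
  have hsq : ∀ i : ℤ, (1 + ε₀) ^ ((5 : ℝ) * i / 2) * (Zb i + r / Cw) ^ 2 =
      ((1 + ε₀) ^ ((5 : ℝ) * i / 4) * (Zb i + r / Cw)) ^ 2 := by
    intro i
    have : (1 + ε₀) ^ ((5 : ℝ) * i / 2) = ((1 + ε₀) ^ ((5 : ℝ) * i / 4)) ^ 2 := by
      rw [← Real.rpow_natCast, ← Real.rpow_mul hq.le]; norm_num; ring_nf
    rw [this]; ring
  have hmono : (1 + ε₀) ^ ((5 : ℝ) * j / 4) * (Zb j + r / Cw) ≤ (1 + ε₀) ^ ((5 : ℝ) * j₀ / 4) * (Zb j₀ + r / Cw) := by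
    rw [hZb, hZb, mul_add, mul_add]
    refine add_le_add ?_ ?_
    · have e1 : (1 + ε₀) ^ ((5 : ℝ) * j / 4) * (Cb * (1 + ε₀) ^ (-(γ * j))) =
          Cb * (1 + ε₀) ^ ((5 / 4 - γ) * j) := by
        rw [show (5 / 4 - γ) * (j : ℝ) = (5 : ℝ) * j / 4 + -(γ * j) by ring, Real.rpow_add hq]; ring
      have e2 : (1 + ε₀) ^ ((5 : ℝ) * j₀ / 4) * (Cb * (1 + ε₀) ^ (-(γ * j₀))) =
          Cb * (1 + ε₀) ^ ((5 / 4 - γ) * j₀) := by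
        rw [show (5 / 4 - γ) * (j₀ : ℝ) = (5 : ℝ) * j₀ / 4 + -(γ * j₀) by ring, Real.rpow_add hq]; ring
      rw [e1, e2]
      exact mul_le_mul_of_nonneg_left (Real.rpow_le_rpow_of_exponent_le hq1 (by nlinarith)) hCb.le
    · exact mul_le_mul_of_nonneg_right (Real.rpow_le_rpow_of_exponent_le hq1 (by nlinarith)) hρ₀
  have h0 : 0 ≤ (1 + ε₀) ^ ((5 : ℝ) * j / 4) * (Zb j + r / Cw) := by
    have := wake_pos hε hCb hZb j; positivity
  rw [hsq, hsq]
  exact pow_le_pow_left₀ h0 hmono 2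

/-- **FROZEN-WAKE DRIFT BOUND**: for every `j < -Kb` the drift majorant is at most
`Dmax = 32 c Cα (1+ε₀)^{2γ} (1+ε₀)^{-5(Kb+1)/2}(Zb(-Kb-1) + r/Cw)²` (`γ ≤ 5/4`). [folklore] -/
theorem wake_drift (hε : 0 < ε₀) (hCb : 0 < Cb) (hγ : 0 ≤ γ) (hγ1 : γ ≤ 1) (hr : 0 ≤ r) (hCw : 1 ≤ Cw)
    (hc : 0 ≤ c) (hCα : 0 ≤ Cα) (hZb : ∀ j : ℤ, Zb j = Cb * (1 + ε₀) ^ (-(γ * j)))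
    (hZf : ∀ j : ℤ, Zf j = 2 * (Zb j + r / Cw)) :
    ∀ j, j < -Kb →
      c * (8 * Cα * (1 + ε₀) ^ ((5 : ℝ) * j / 2) *
        max (Zf (j - 1)) (max (Zf j) (Zf (j + 1))) * max (Zf (j - 1)) (max (Zf j) (Zf (j + 1)))) ≤
        32 * c * Cα * (1 + ε₀) ^ (2 * γ) *
          ((1 + ε₀) ^ ((5 : ℝ) * ((-Kb - 1 : ℤ) : ℝ) / 2) * (Zb (-Kb - 1) + r / Cw) ^ 2) := by
  intro j hj
  have hq : 0 < 1 + ε₀ := by linarith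
  refine (wake_drift_le hε hCb hγ hr hCw hc hCα hZb hZf j).trans ?_
  have hK : 0 ≤ 32 * c * Cα * (1 + ε₀) ^ (2 * γ) := by
    have := Real.rpow_pos_of_pos hq (2 * γ); positivity
  exact mul_le_mul_of_nonneg_left
    (wake_g_mono hε hCb (by linarith) hr hCw hZb (show j ≤ -Kb - 1 by omega)) hK

/-- The relative wake quantity `h(i) = (1+ε₀)^{(5/4+γ/2) i}(Zb i + r/Cw)` increases with `i` (`γ ≤ 5/2`).
[folklore] -/
theorem wake_h_mono (hε : 0 < ε₀) (hCb : 0 < Cb) (hγ0 : 0 ≤ γ) (hγ : γ ≤ 5 / 2) (hr : 0 ≤ r) (hCw : 1 ≤ Cw)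
    (hZb : ∀ j : ℤ, Zb j = Cb * (1 + ε₀) ^ (-(γ * j))) {j j₀ : ℤ} (hj : j ≤ j₀) :
    (1 + ε₀) ^ ((5 / 4 + γ / 2) * j) * (Zb j + r / Cw) ≤
      (1 + ε₀) ^ ((5 / 4 + γ / 2) * j₀) * (Zb j₀ + r / Cw) := by
  have hq : 0 < 1 + ε₀ := by linarith
  have hq1 : 1 ≤ 1 + ε₀ := by linarith
  have hjr : (j : ℝ) ≤ j₀ := by exact_mod_cast hj
  have hρ₀ : 0 ≤ r / Cw := div_nonneg hr (by linarith)
  rw [hZb j, hZb j₀, mul_add, mul_add]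
  refine add_le_add ?_ ?_
  · have e1 : (1 + ε₀) ^ ((5 / 4 + γ / 2) * j) * (Cb * (1 + ε₀) ^ (-(γ * j))) =
        Cb * (1 + ε₀) ^ ((5 / 4 - γ / 2) * j) := by
      rw [show (5 / 4 - γ / 2) * (j : ℝ) = (5 / 4 + γ / 2) * j + -(γ * j) by ring, Real.rpow_add hq]
      ring
    have e2 : (1 + ε₀) ^ ((5 / 4 + γ / 2) * j₀) * (Cb * (1 + ε₀) ^ (-(γ * j₀))) =
        Cb * (1 + ε₀) ^ ((5 / 4 - γ / 2) * j₀) := by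
      rw [show (5 / 4 - γ / 2) * (j₀ : ℝ) = (5 / 4 + γ / 2) * j₀ + -(γ * j₀) by ring, Real.rpow_add hq]
      ring
    rw [e1, e2]
    exact mul_le_mul_of_nonneg_left (Real.rpow_le_rpow_of_exponent_le hq1 (by nlinarith)) hCb.le
  · exact mul_le_mul_of_nonneg_right (Real.rpow_le_rpow_of_exponent_le hq1 (by nlinarith)) hρ₀

/-- The drift majorant relative to the envelope increases with `j`: `g(j)·Zb(j₀) ≤ g(j₀)·Zb(j)` for `j ≤ j₀`
(`g(i) = (1+ε₀)^{5i/2}(Zb i + r/Cw)²`; equivalently `g/Zb` is increasing). [folklore] -/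
theorem wake_g_rel_mono (hε : 0 < ε₀) (hCb : 0 < Cb) (hγ : 0 ≤ γ) (hγ1 : γ ≤ 1) (hr : 0 ≤ r) (hCw : 1 ≤ Cw)
    (hZb : ∀ j : ℤ, Zb j = Cb * (1 + ε₀) ^ (-(γ * j))) {j j₀ : ℤ} (hj : j ≤ j₀) :
    (1 + ε₀) ^ ((5 : ℝ) * j / 2) * (Zb j + r / Cw) ^ 2 * Zb j₀ ≤
      (1 + ε₀) ^ ((5 : ℝ) * j₀ / 2) * (Zb j₀ + r / Cw) ^ 2 * Zb j := by
  have hq : 0 < 1 + ε₀ := by linarith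
  -- g(i) · (Cb q^{γ i}) = Cb · h(i)²  and  Zb i · q^{γ i} = Cb
  have hh : ∀ i : ℤ, (1 + ε₀) ^ ((5 : ℝ) * i / 2) * (Zb i + r / Cw) ^ 2 * (1 + ε₀) ^ (γ * i) =
      ((1 + ε₀) ^ ((5 / 4 + γ / 2) * i) * (Zb i + r / Cw)) ^ 2 := by
    intro i
    have e : (1 + ε₀) ^ ((5 : ℝ) * i / 2) * (1 + ε₀) ^ (γ * i) = ((1 + ε₀) ^ ((5 / 4 + γ / 2) * i)) ^ 2 := by
      rw [← Real.rpow_add hq, ← Real.rpow_natCast, ← Real.rpow_mul hq.le]; norm_num; ring_nf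
    calc (1 + ε₀) ^ ((5 : ℝ) * i / 2) * (Zb i + r / Cw) ^ 2 * (1 + ε₀) ^ (γ * i)
        = ((1 + ε₀) ^ ((5 : ℝ) * i / 2) * (1 + ε₀) ^ (γ * i)) * (Zb i + r / Cw) ^ 2 := by ring
      _ = ((1 + ε₀) ^ ((5 / 4 + γ / 2) * i) * (Zb i + r / Cw)) ^ 2 := by rw [e]; ring
  have hinv : ∀ i : ℤ, Zb i * (1 + ε₀) ^ (γ * i) = Cb := by
    intro i; rw [hZb, mul_assoc, ← Real.rpow_add hq, neg_add_cancel, Real.rpow_zero, mul_one]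
  have hpos1 : 0 < (1 + ε₀) ^ (γ * j) := Real.rpow_pos_of_pos hq _
  have hpos2 : 0 < (1 + ε₀) ^ (γ * j₀) := Real.rpow_pos_of_pos hq _
  have h0 : 0 ≤ (1 + ε₀) ^ ((5 / 4 + γ / 2) * j) * (Zb j + r / Cw) := by
    have := Real.rpow_pos_of_pos hq ((5 / 4 + γ / 2) * j); have := wake_pos hε hCb hZb j
    have : 0 ≤ r / Cw := div_nonneg hr (by linarith); positivity
  have hsqle := pow_le_pow_left₀ h0 (wake_h_mono hε hCb hγ (by linarith) hr hCw hZb hj) 2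
  -- multiply the goal by q^{γ j} q^{γ j₀} > 0
  refine le_of_mul_le_mul_right ?_ (mul_pos hpos1 hpos2)
  have l1 : (1 + ε₀) ^ ((5 : ℝ) * j / 2) * (Zb j + r / Cw) ^ 2 * Zb j₀ *
      ((1 + ε₀) ^ (γ * j) * (1 + ε₀) ^ (γ * j₀)) =
      ((1 + ε₀) ^ ((5 : ℝ) * j / 2) * (Zb j + r / Cw) ^ 2 * (1 + ε₀) ^ (γ * j)) *
        (Zb j₀ * (1 + ε₀) ^ (γ * j₀)) := by ring
  have l2 : (1 + ε₀) ^ ((5 : ℝ) * j₀ / 2) * (Zb j₀ + r / Cw) ^ 2 * Zb j *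
      ((1 + ε₀) ^ (γ * j) * (1 + ε₀) ^ (γ * j₀)) =
      ((1 + ε₀) ^ ((5 : ℝ) * j₀ / 2) * (Zb j₀ + r / Cw) ^ 2 * (1 + ε₀) ^ (γ * j₀)) *
        (Zb j * (1 + ε₀) ^ (γ * j)) := by ring
  rw [l1, l2, hh j, hh j₀, hinv j, hinv j₀]
  exact mul_le_mul_of_nonneg_right hsqle hCb.le

/-- **WAKE-SHIFT from one scalar check** (with the majorised drift `K·g(j)`, `K = 32 c Cα (1+ε₀)^{2γ}`): if
`(1+ε₀)^{θ₀}·(Zb j₀ + r/Cw + K·g(j₀)) ≤ Zb(j₀ - 1)` at `j₀ = -Kb-1`, then the wake-shift inequality holds for every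
`j < -Kb` (the relative quantities `(r/Cw)/Zb j` and `g(j)/Zb j` shrink with depth). Weights `w j = Cw` behind.
[folklore] -/
theorem wake_shift (hε : 0 < ε₀) (hCb : 0 < Cb) (hγ : 0 ≤ γ) (hγ1 : γ ≤ 1) (hr : 0 ≤ r) (hCw : 1 ≤ Cw)
    (hc : 0 ≤ c) (hCα : 0 ≤ Cα) (hZb : ∀ j : ℤ, Zb j = Cb * (1 + ε₀) ^ (-(γ * j)))
    (hZf : ∀ j : ℤ, Zf j = 2 * (Zb j + r / Cw)) (hwn : ∀ k : ℤ, k < 0 → w k = Cw) (hKb : 0 ≤ Kb)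
    (hcheck : (1 + ε₀) ^ θ₀ * (Zb (-Kb - 1) + r / Cw +
      32 * c * Cα * (1 + ε₀) ^ (2 * γ) *
        ((1 + ε₀) ^ ((5 : ℝ) * ((-Kb - 1 : ℤ) : ℝ) / 2) * (Zb (-Kb - 1) + r / Cw) ^ 2)) ≤ Zb (-Kb - 1 - 1)) :
    ∀ j, j < -Kb →
      (1 + ε₀) ^ θ₀ * (Zb j + r / w j + c * (8 * Cα * (1 + ε₀) ^ ((5 : ℝ) * j / 2) *
        max (Zf (j - 1)) (max (Zf j) (Zf (j + 1))) * max (Zf (j - 1)) (max (Zf j) (Zf (j + 1))))) ≤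
        Zb (j - 1) := by
  intro j hj
  have hq : 0 < 1 + ε₀ := by linarith
  have hρ₀ : 0 ≤ r / Cw := div_nonneg hr (by linarith)
  have hjj₀ : j ≤ -Kb - 1 := by omega
  have hqθ : 0 ≤ (1 + ε₀) ^ θ₀ := (Real.rpow_pos_of_pos hq _).le
  rw [hwn j (by omega)]
  -- abbreviations
  set K : ℝ := 32 * c * Cα * (1 + ε₀) ^ (2 * γ) with hK
  have hK0 : 0 ≤ K := by have := Real.rpow_pos_of_pos hq (2 * γ); positivity
  set g : ℤ → ℝ := fun i => (1 + ε₀) ^ ((5 : ℝ) * i / 2) * (Zb i + r / Cw) ^ 2 with hg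
  set j₀ : ℤ := -Kb - 1 with hj₀
  have hZbj := wake_pos hε hCb hZb j
  have hZbj₀ := wake_pos hε hCb hZb j₀
  -- Step 1: the drift is at most K · g j
  have hD : c * (8 * Cα * (1 + ε₀) ^ ((5 : ℝ) * j / 2) *
      max (Zf (j - 1)) (max (Zf j) (Zf (j + 1))) * max (Zf (j - 1)) (max (Zf j) (Zf (j + 1)))) ≤ K * g j :=
    wake_drift_le hε hCb hγ hr hCw hc hCα hZb hZf j
  -- Step 2: relative monotonicity: (ρ₀ + K g j) · Zb j₀ ≤ (ρ₀ + K g j₀) · Zb j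
  have hmono1 : Zb j₀ ≤ Zb j := wake_mono hε hCb hγ hZb hjj₀
  have hterm2 : g j * Zb j₀ ≤ g j₀ * Zb j := wake_g_rel_mono hε hCb hγ hγ1 hr hCw hZb hjj₀
  have hratio : (r / Cw + K * g j) * Zb j₀ ≤ (r / Cw + K * g j₀) * Zb j := by
    have h1 : r / Cw * Zb j₀ ≤ r / Cw * Zb j := mul_le_mul_of_nonneg_left hmono1 hρ₀
    have h2 : K * (g j * Zb j₀) ≤ K * (g j₀ * Zb j) := mul_le_mul_of_nonneg_left hterm2 hK0
    calc (r / Cw + K * g j) * Zb j₀ = r / Cw * Zb j₀ + K * (g j * Zb j₀) := by ring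
      _ ≤ r / Cw * Zb j + K * (g j₀ * Zb j) := add_le_add h1 h2
      _ = (r / Cw + K * g j₀) * Zb j := by ring
  -- Step 3: the check at j₀, written as  q^{θ₀}(ρ₀ + K g j₀) ≤ (q^γ − q^{θ₀}) Zb j₀
  have hstep₀ : Zb (j₀ - 1) = (1 + ε₀) ^ γ * Zb j₀ := wake_step hε hZb j₀
  have hc1 : (1 + ε₀) ^ θ₀ * (r / Cw + K * g j₀) ≤ ((1 + ε₀) ^ γ - (1 + ε₀) ^ θ₀) * Zb j₀ := by
    have h := hcheck
    rw [hstep₀] at h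
    have e : (1 + ε₀) ^ θ₀ * (Zb j₀ + r / Cw + K * g j₀) =
        (1 + ε₀) ^ θ₀ * Zb j₀ + (1 + ε₀) ^ θ₀ * (r / Cw + K * g j₀) := by ring
    rw [e] at h
    linarith
  -- Step 4: transport to shell j
  have hc2 : (1 + ε₀) ^ θ₀ * (r / Cw + K * g j) * Zb j₀ ≤ (((1 + ε₀) ^ γ - (1 + ε₀) ^ θ₀) * Zb j) * Zb j₀ :=
    calc (1 + ε₀) ^ θ₀ * (r / Cw + K * g j) * Zb j₀
        = (1 + ε₀) ^ θ₀ * ((r / Cw + K * g j) * Zb j₀) := by ring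
      _ ≤ (1 + ε₀) ^ θ₀ * ((r / Cw + K * g j₀) * Zb j) := mul_le_mul_of_nonneg_left hratio hqθ
      _ = ((1 + ε₀) ^ θ₀ * (r / Cw + K * g j₀)) * Zb j := by ring
      _ ≤ (((1 + ε₀) ^ γ - (1 + ε₀) ^ θ₀) * Zb j₀) * Zb j := mul_le_mul_of_nonneg_right hc1 hZbj.le
      _ = (((1 + ε₀) ^ γ - (1 + ε₀) ^ θ₀) * Zb j) * Zb j₀ := by ring
  have hc3 : (1 + ε₀) ^ θ₀ * (r / Cw + K * g j) ≤ ((1 + ε₀) ^ γ - (1 + ε₀) ^ θ₀) * Zb j :=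
    le_of_mul_le_mul_right hc2 hZbj₀
  -- Step 5: conclude
  rw [wake_step hε hZb j]
  calc (1 + ε₀) ^ θ₀ * (Zb j + r / Cw + c * (8 * Cα * (1 + ε₀) ^ ((5 : ℝ) * j / 2) *
        max (Zf (j - 1)) (max (Zf j) (Zf (j + 1))) * max (Zf (j - 1)) (max (Zf j) (Zf (j + 1)))))
      ≤ (1 + ε₀) ^ θ₀ * (Zb j + r / Cw + K * g j) := by
        refine mul_le_mul_of_nonneg_left ?_ hqθ; linarith
    _ = (1 + ε₀) ^ θ₀ * Zb j + (1 + ε₀) ^ θ₀ * (r / Cw + K * g j) := by ring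
    _ ≤ (1 + ε₀) ^ θ₀ * Zb j + ((1 + ε₀) ^ γ - (1 + ε₀) ^ θ₀) * Zb j := by linarith
    _ = (1 + ε₀) ^ γ * Zb j := by ring

end Wake

end CertificateGlueOn

end Summit.NavierStokesRegularity.NavierStokesRegularity.Theorems

end
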